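import Literature.Probability.Percolation.SlabRSWGluingExt
import HarnessLib

/-!
# Newman–Tassion–Wu 2017, §3.2 — GL (Thm. 3.7) with `S ⊊ R`: contacts behind the target side, and the linear bound

Topic: `Literature/Probability/Percolation`. Second file of the extended-rectangle setting
(`SlabRSWGluingExt.lean`: `S = [a,b]×[c,d] ⊆ R = [a,b']×[c,d']`, target `B = {b}×[c,d]` the right side
of `S`, a column in the interior of `R`). When the cleared box around the contact point reaches the
column `x = b`, the `C`-path (which lives in `R̄ ⊋ S̄`) may enter the box from the right of that column
or from above `S` — behind `B̄` as seen from `Γ`. The local modification is then a surgery ENDING IN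
`B̄` (`GlueData.SurgeryB`): the trunk runs from the first vertex of `Γ` over the box, inside
`box ∩ S ∖ {x = b}`, to a chosen `β ∈ B̄`; the branch is the tree's routed branch to an anchor on the
column `x = b - 1` followed by an EXTERIOR lifted L-path through the columns `x ≥ b` to the port of the
`C`-path, at the port's height; `β` is taken at the other height, so that it misses the exterior path.

* `RouteSpec.append_branch` — appending a lattice chain to the branch of a route.
* `exists_surgeryB_ext` — the surgery when the box reaches the column `x = b`.
* `exists_gadget_ext` — every configuration of `𝒳` has a `GadgetSpec` of radius `3ρ + 3`.
* **`real_evAB_inter_evNear_le_ext`** — NTW's Theorem 3.7 in the linear regime for the extended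
  rectangle: `P_p[A ⟷^S B, C̄ ⟷^{R̄} 𝒩(Γ̄, ρ)] ≤ (1 + λ^s) · P_p[C ⟷^R A]`, `λ = 2/min{p,1-p}`,
  `s = 3(5k+4)(12ρ+13)²`.

## Sources

* C. M. Newman, V. Tassion, W. Wu, *Critical percolation and the minimal spanning tree in slabs*,
  Comm. Pure Appl. Math. 70 (2017), arXiv:1512.09107: §3.2, Theorem 3.7 (with Remark 3: `h₀(x) ≥ c₀x`)
  and its proof, second part (`P[𝒳] ≤ C₃ P[𝒳′]`, p. 10); §3.5, proof of Theorem 3.14, Case 2 (p. 17)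
  [NewmanTassionWu2017].
-/

noncomputable section

namespace Literature.Probability.Percolation

open MeasureTheory LatticeModels SimpleGraph

namespace NTW17

variable {k : ℕ}

/-! ## Appending a chain to the branch of a route -/

section Append

variable {RP Db : Set (ℤ × ℤ)} {E₁ E₂ c : slab 3 k} {L : List (slab 3 k)}

/-- **Appending a lattice chain to the branch of a route**: if `X` continues the branch from its end
`w''` as a self-avoiding lattice chain off the trunk and off the branch, inside the branch region, the
result is a route to the last vertex of `X`. [cite: NewmanTassionWu2017, §3.2 (proof of Theorem 3.7, step (3), the path γ_w)] -/
theorem RouteSpec.append_branch :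
    ∀ (X : List (slab 3 k)) (w'' : slab 3 k) (Br : List (slab 3 k)) (hX : X ≠ []),
      RouteSpec k RP Db E₁ E₂ w'' L Br c →
      (w'' :: X).IsChain (fun a b => (slabGraph 3 k).Adj a b) → X.Nodup →
      (∀ x ∈ X, x ∉ L) → (∀ x ∈ X, x ∉ c :: Br) → (∀ x ∈ X, planar k x ∈ Db) →
      RouteSpec k RP Db E₁ E₂ (X.getLast hX) L (Br ++ X) c
  | [], _, _, hX, _, _, _, _, _, _ => absurd rfl hX
  | x :: X', w'', Br, hX, h, hch, hnd, hXL, hXBr, hXD => by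
    have hadj : (slabGraph 3 k).Adj w'' x := by
      rw [List.isChain_cons] at hch
      exact hch.1 x (by simp)
    have hch' : (x :: X').IsChain (fun a b => (slabGraph 3 k).Adj a b) := by
      rw [List.isChain_cons] at hch
      exact hch.2
    have h₁ : RouteSpec k RP Db E₁ E₂ x L (Br ++ [x]) c :=
      RouteSpec.concat_branch h subset_rfl hadj (hXL x (by simp)) (hXBr x (by simp)) (hXD x (by simp))
    by_cases hX' : X' = []
    · subst hX'
      simpa using h₁
    · have hxX' : x ∉ X' := (List.nodup_cons.1 hnd).1
      have ih := RouteSpec.append_branch X' x (Br ++ [x]) hX' h₁ hch' (List.nodup_cons.1 hnd).2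
        (fun y hy => hXL y (List.mem_cons_of_mem _ hy))
        (fun y hy hm => by
          rcases List.mem_cons.1 hm with hm | hm
          · exact hXBr y (List.mem_cons_of_mem _ hy) (List.mem_cons.2 (Or.inl hm))
          · rcases List.mem_append.1 hm with hm | hm
            · exact hXBr y (List.mem_cons_of_mem _ hy) (List.mem_cons_of_mem _ hm)
            · rw [List.mem_singleton] at hm
              exact hxX' (hm ▸ hy))
        (fun y hy => hXD y (List.mem_cons_of_mem _ hy))
      rw [List.getLast_cons hX']
      simpa using ih

end Append

/-! ## Choosing rows -/

/-- Among four consecutive rows one avoids three given values. [cite: NewmanTassionWu2017, §3.2 (proof of Theorem 3.7, step (1), "u, v, w are chosen to be distinct")] -/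
theorem exists_row_avoid {rB rP : ℤ} (h : rB + 3 ≤ rP) (u v w : ℤ) :
    ∃ y : ℤ, rB ≤ y ∧ y ≤ rP ∧ y ≠ u ∧ y ≠ v ∧ y ≠ w := by
  by_cases h0 : rB ≠ u ∧ rB ≠ v ∧ rB ≠ w
  · exact ⟨rB, le_rfl, by omega, h0.1, h0.2.1, h0.2.2⟩
  by_cases h1 : rB + 1 ≠ u ∧ rB + 1 ≠ v ∧ rB + 1 ≠ w
  · exact ⟨rB + 1, by omega, by omega, h1.1, h1.2.1, h1.2.2⟩
  by_cases h2 : rB + 2 ≠ u ∧ rB + 2 ≠ v ∧ rB + 2 ≠ w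
  · exact ⟨rB + 2, by omega, by omega, h2.1, h2.2.1, h2.2.2⟩
  refine ⟨rB + 3, by omega, h, ?_, ?_, ?_⟩ <;> omega

/-! ## The surgery ending in `B̄`: the cleared box reaches the column `x = b` -/

section Behind

variable {E : ExtSetup} {ω : BondConfig (slab 3 k)} {ρ : ℕ}

/-- **Contact whose cleared box reaches the target column** (NTW, proof of Thm. 3.7, steps (1)–(3),
`S ⊊ R`): given a normalised contact inside `R̄` with no cell of `A` or `C` within `ρ + 3` of
`z = planar q` and `b ≤ z.1 + ρ + 3`, there is a `SurgeryB` whose cleared set is `(z + B_{ρ+3}) ∩ R`: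
trunk from the first vertex of `Γ` over the box through `box ∩ S ∖ {x = b}` to `β ∈ B̄`; branch to
the port `w'` of the `C`-path — routed inside the box left of `x = b` when `w'` is there, else routed
to an anchor on the column `x = b - 1` and continued by a lifted L-path through the columns `x ≥ b`
at the height of `w'` (and `β` at the other height).
[cite: NewmanTassionWu2017, §3.2 (proof of Theorem 3.7, steps (1)–(3)); §3.5 (proof of Theorem 3.14, Case 2)] -/
theorem exists_surgeryB_ext (hk : 1 ≤ k) (hρ : 2 ≤ ρ) (hω : ω ⊆ (slabGraph 3 k).edgeSet)
    (hX : ω ∈ E.Q.evX k) {c₀ q : slab 3 k} {l : List (slab 3 k)} (hc₀ : c₀ ∈ slabLift k E.C)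
    (hch : (l ++ [q]).IsChain (fun a b => s(a, b) ∈ ω ∧ a ≠ b)) (hnd : (l ++ [q]).Nodup)
    (hsub : ∀ x ∈ l ++ [q], x ∈ slabLift k E.R) (hhead : (l ++ [q]).head (by simp) = c₀)
    (hnear : Near k (E.Q.γ k ω) ρ (planar k q)) (hfar : ∀ x ∈ l, ¬Near k (E.Q.γ k ω) ρ (planar k x))
    (hnA : ∀ a' ∈ E.A, a' ∉ sqBox (planar k q) (ρ + 3))
    (hnC : ∀ c' ∈ E.C, c' ∉ sqBox (planar k q) (ρ + 3))
    (hcol : E.b ≤ (planar k q).1 + (ρ + 3)) :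
    ∃ sb : E.Q.SurgeryB k ω, sb.D ⊆ sqBox (planar k q) (ρ + 3) := by
  have hA : ω ∈ E.Q.evAB k := hX.1
  obtain ⟨hγO, -⟩ := E.Q.γ_spec hA
  set z := planar k q with hzdef
  set r : ℕ := ρ + 3 with hrdef
  set D := E.Dbox z r with hDdef
  set K := E.Kbox z r with hKdef
  set Kp := E.Kplus z r with hKpdef
  have hzR : z ∈ E.R := hsub q (by simp)
  obtain ⟨hz1, hz2, hz3, hz4⟩ := contact_bounds hA hzR hnear
  have hzR' := hzR
  rw [ExtSetup.mem_R_iff] at hzR'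
  have hab := E.hab; have hcd := E.hcd; have hbb' := E.hbb'; have hdd' := E.hdd'
  have hDz : D ⊆ sqBox z (ρ + 3) := ExtSetup.Dbox_subset_sqBox _ _
  have hKD : K ⊆ D := ExtSetup.Kbox_subset_Dbox _ _
  have hKpD : Kp ⊆ D := ExtSetup.Kplus_subset_Dbox _ _
  have hKKp : K ⊆ Kp := ExtSetup.Kbox_subset_Kplus _ _
  have hl : l ≠ [] := contact_ne_nil (Q := E.Q) hc₀ hhead hnC
  have hzD : z ∈ D := ExtSetup.mem_Dbox_iff.2 ⟨hzR, mem_sqBox_self _ _⟩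
  have hc₀D : planar k c₀ ∉ D := fun h => hnC _ hc₀ (hDz h)
  have hDA : ∀ w ∈ D, w ∉ E.Q.A := fun w hw hwA => hnA w hwA (hDz hw)
  -- membership criteria
  have memK : ∀ w : ℤ × ℤ, E.a ≤ w.1 → w.1 ≤ E.b - 1 → z.1 - r ≤ w.1 → w.1 ≤ z.1 + r →
      E.c ≤ w.2 → w.2 ≤ E.d → z.2 - r ≤ w.2 → w.2 ≤ z.2 + r → w ∈ K := by
    intro w h1 h2 h3 h4 h5 h6 h7 h8
    rw [ExtSetup.mem_Kbox_iff, ExtSetup.mem_S_iff, mem_sqBox_iff']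
    exact ⟨⟨h1, by omega, h5, h6⟩, ⟨h3, h4, h7, h8⟩, by omega⟩
  have memD : ∀ w : ℤ × ℤ, w ∈ D → E.a ≤ w.1 ∧ w.1 ≤ E.b' ∧ z.1 - r ≤ w.1 ∧ w.1 ≤ z.1 + r ∧
      E.c ≤ w.2 ∧ w.2 ≤ E.d' ∧ z.2 - r ≤ w.2 ∧ w.2 ≤ z.2 + r := by
    intro w hw
    rw [ExtSetup.mem_Dbox_iff, ExtSetup.mem_R_iff, mem_sqBox_iff'] at hw
    omega
  have memD' : ∀ w : ℤ × ℤ, E.a ≤ w.1 → w.1 ≤ E.b' → z.1 - r ≤ w.1 → w.1 ≤ z.1 + r →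
      E.c ≤ w.2 → w.2 ≤ E.d' → z.2 - r ≤ w.2 → w.2 ≤ z.2 + r → w ∈ D := by
    intro w h1 h2 h3 h4 h5 h6 h7 h8
    rw [ExtSetup.mem_Dbox_iff, ExtSetup.mem_R_iff, mem_sqBox_iff']
    exact ⟨⟨h1, h2, h5, h6⟩, ⟨h3, h4, h7, h8⟩⟩
  have notK_b : ∀ w : ℤ × ℤ, E.b ≤ w.1 → w ∉ K := by
    intro w hw h
    rw [ExtSetup.mem_Kbox_iff, ExtSetup.mem_S_iff] at h
    omega
  -- the port
  obtain ⟨w', q₁, hadj, hw'D, hq₁D, hσ, hw'far⟩ :=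
    exists_port (Q := E.Q) hω hch hnd hsub hhead hfar hl (by omega) hzD hc₀D
  -- a vertex of `γ` over `D` other than the last
  obtain ⟨g₀, hg₀, hz⟩ := hnear
  have hg₀z : planar k g₀ ∈ sqBox z ρ := GlueGeom.mem_sqBox_comm hz
  have hg₀h := ne_head_of_far_A (Q := E.Q) hA hz (by omega : ρ ≤ ρ + 3) hnA
  have hin : ∃ x ∈ E.Q.γ k ω, planar k x ∈ D ∧ x ≠ (E.Q.γ k ω).getLast hγO.ne_nil := by
    by_cases hlast : g₀ = (E.Q.γ k ω).getLast hγO.ne_nil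
    · obtain ⟨u, huγ, hadj₀, -, hul⟩ := exists_pred hω hA hg₀ hg₀h
      refine ⟨u, huγ, ExtSetup.mem_Dbox_iff.2 ⟨E.S_subset_R (hγO.subset u huγ),
        sqBox_mono _ (by omega : ρ + 1 ≤ r) ?_⟩, hul⟩
      exact mem_sqBox_add hg₀z (planar_mem_sqBox_one_of_adj hadj₀.symm)
    · exact ⟨g₀, hg₀, ExtSetup.mem_Dbox_iff.2 ⟨E.S_subset_R (hγO.subset g₀ hg₀),
        sqBox_mono _ (by omega) hg₀z⟩, hlast⟩
  -- the decomposition at the first vertex over `D`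
  obtain ⟨p₀, E₁, rest, hγeq, hp₀, hrest, hp₀D, hE₁D⟩ := exists_decompB (Q := E.Q) hA hDA hin
  have hE₁γ : E₁ ∈ E.Q.γ k ω := by rw [hγeq]; simp
  have hE₁B : planar k E₁ ∉ E.B := by
    intro hB'
    have hex : ∃ l, IsOSAP k ω (slabLift k E.Q.S) (slabLift k E.Q.A) (slabLift k E.Q.B) l :=
      (mem_slabConn_iff_exists_isOSAP ω _ _ _).1 hA
    have h := minPath_prefix_getLast_not_mem E.Q.S_finite hex (p := p₀ ++ [E₁]) (s := rest)
      (by rw [show minPath k ω _ _ _ = E.Q.γ k ω from rfl, hγeq]; simp) hrest (by simp)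
    simp at h
    exact h hB'
  have hE₁S : planar k E₁ ∈ E.S := hγO.subset E₁ hE₁γ
  have hE₁K : planar k E₁ ∈ K :=
    ExtSetup.mem_Kbox_of hE₁S (hDz hE₁D) (fun hb => hE₁B ⟨hE₁S, hb⟩)
  set e₁ := planar k E₁ with he₁def
  set ew := planar k w' with hewdef
  set h : ℕ := ht w' with hhdef
  have hhk : h ≤ k := ht_le w'
  obtain ⟨hw1, hw2, hw3, hw4, hw5, hw6, hw7, hw8⟩ := memD _ hw'D
  -- the rows of the trunk box
  set rB : ℤ := max E.c (z.2 - r) with hrBdef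
  set rP : ℤ := min E.d (z.2 + r) with hrPdef
  have hrows : rB + 3 ≤ rP := by
    simp only [hrBdef, hrPdef, max_add, le_min_iff, max_le_iff]
    omega
  -- the anchor row and the row of `β`
  obtain ⟨ya, hya1, hya2, hyae, -, -⟩ := exists_row_avoid hrows e₁.2 e₁.2 e₁.2
  obtain ⟨yβ, hyβ1, hyβ2, hyβe, hyβa, hyβw⟩ := exists_row_avoid hrows e₁.2 ya ew.2
  have hya : E.c ≤ ya ∧ ya ≤ E.d ∧ z.2 - r ≤ ya ∧ ya ≤ z.2 + r := by
    simp only [hrBdef, hrPdef, max_le_iff, le_min_iff] at hya1 hya2; omega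
  have hyβ : E.c ≤ yβ ∧ yβ ≤ E.d ∧ z.2 - r ≤ yβ ∧ yβ ≤ z.2 + r := by
    simp only [hrBdef, hrPdef, max_le_iff, le_min_iff] at hyβ1 hyβ2; omega
  -- the height of `β`: not the port's
  set hβ : ℕ := if h = 0 then 1 else 0 with hhβdef
  have hhβk : hβ ≤ k := by rw [hhβdef]; split_ifs <;> omega
  have hhβne : hβ ≠ h := by rw [hhβdef]; split_ifs with h' <;> omega
  set β : slab 3 k := vtx k (E.b, yβ) hβ with hβdef
  set β' : slab 3 k := vtx k (E.b - 1, yβ) hβ with hβ'def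
  have hβp : planar k β = (E.b, yβ) := planar_vtx _ _
  have hβ'p : planar k β' = (E.b - 1, yβ) := planar_vtx _ _
  have hβht : ht β = hβ := ht_vtx hhβk _
  have hβS : planar k β ∈ E.S := by
    rw [hβp, ExtSetup.mem_S_iff]; dsimp only; omega
  have hβB : planar k β ∈ E.B := ⟨hβS, by rw [hβp]⟩
  have hβD : planar k β ∈ D := by
    rw [hβp]; refine memD' _ ?_ ?_ ?_ ?_ ?_ ?_ ?_ ?_ <;> dsimp only <;> omega
  have hβ'K : planar k β' ∈ K := by
    rw [hβ'p]; refine memK _ ?_ ?_ ?_ ?_ ?_ ?_ ?_ ?_ <;> dsimp only <;> omega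
  have hadjβ : (slabGraph 3 k).Adj β' β := by
    refine adj_of_planarAdj (by rw [hβdef, hβ'def, ht_vtx hhβk, ht_vtx hhβk]) ?_
    rw [hβp, hβ'p]
    exact planarAdj_left (by simp) (by simp)
  have hE₁β' : E₁ ≠ β' := by
    intro hE
    have := congrArg (fun v => (planar k v).2) hE
    simp only [hβ'p] at this
    exact hyβe (by rw [he₁def, this])
  have hE₁β : E₁ ≠ β := fun hE => hE₁B (by rw [he₁def, hE]; exact hβB)
  have notK_L : ∀ {L : List (slab 3 k)}, (∀ v ∈ L, planar k v ∈ K) → β ∉ L := fun hL hm =>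
    notK_b _ (by rw [hβp]) (hL β hm)
  -- the route: trunk `E₁ → β'` in `K`, branch to `w'` inside `D`
  obtain ⟨L, Br₁, c, spec₁, hLK, hβBr₁⟩ : ∃ L Br₁ c, RouteSpec k D D E₁ β' w' L Br₁ c ∧
      (∀ v ∈ L, planar k v ∈ K) ∧ β ∉ Br₁ := by
    by_cases hcase : ew.1 ≤ E.b - 1
    · -- the port lies left of the column `x = b`: route to it directly (branch box `Kp`)
      have hw'Kp : planar k w' ∈ Kp := by
        rw [ExtSetup.mem_Kplus_iff]
        exact ⟨(ExtSetup.mem_Dbox_iff.1 hw'D).1, (ExtSetup.mem_Dbox_iff.1 hw'D).2, hcase⟩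
      have h0 : ¬Near k (E.Q.γ k ω) 0 (planar k w') := fun hn => hw'far (hn.mono (by omega))
      have hE₁w' : planar k E₁ ≠ planar k w' := (ne_planar_of_not_near h0 hE₁γ).symm
      have hβ'w' : planar k β' ≠ planar k w' := by
        intro hE
        have := congrArg Prod.snd hE
        rw [hβ'p] at this
        exact hyβw (by rw [hewdef, ← this])
      obtain ⟨L, Br, c, spec⟩ := exists_route (xL := max E.a (z.1 - (r : ℕ)))
        (xR' := min (E.b - 1) (z.1 + (r : ℕ))) (xR := min (E.b - 1) (z.1 + (r : ℕ)))
        (rB := max E.c (z.2 - (r : ℕ))) (rP := min E.d (z.2 + (r : ℕ))) (rT := min E.d' (z.2 + (r : ℕ)))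
        hk (by omega) le_rfl (by omega) (by omega) hE₁K hβ'K hw'Kp hE₁β' hE₁w' hβ'w'
      refine ⟨L, Br, c, RouteSpec.mono spec hKD hKpD, spec.hL_sub, fun hm => ?_⟩
      have := spec.hBr_sub β hm
      rw [hβp, mem_boxR_iff] at this
      simp only [max_le_iff, le_min_iff] at this
      omega
    · -- the port lies on or right of the column `x = b`: anchor on `x = b - 1`, exterior L-path
      push Not at hcase
      have hcase' : E.b ≤ ew.1 := by omega
      set w'' : slab 3 k := vtx k (E.b - 1, ya) h with hw''def
      have hw''p : planar k w'' = (E.b - 1, ya) := planar_vtx _ _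
      have hw''K : planar k w'' ∈ K := by
        rw [hw''p]; refine memK _ ?_ ?_ ?_ ?_ ?_ ?_ ?_ ?_ <;> dsimp only <;> omega
      have hE₁w'' : planar k E₁ ≠ planar k w'' := by
        intro hE
        have := congrArg Prod.snd hE
        rw [hw''p] at this
        exact hyae (by rw [he₁def, this])
      have hβ'w'' : planar k β' ≠ planar k w'' := by
        intro hE
        have := congrArg Prod.snd hE
        rw [hβ'p, hw''p] at this
        exact hyβa this
      obtain ⟨L, Br, c, spec⟩ := exists_route (xL := max E.a (z.1 - (r : ℕ)))
        (xR' := min (E.b - 1) (z.1 + (r : ℕ))) (xR := min (E.b - 1) (z.1 + (r : ℕ)))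
        (rB := max E.c (z.2 - (r : ℕ))) (rP := min E.d (z.2 + (r : ℕ))) (rT := min E.d (z.2 + (r : ℕ)))
        hk (by omega) le_rfl (by omega) le_rfl hE₁K hβ'K hw''K hE₁β' hE₁w'' hβ'w''
      have spec' : RouteSpec k K D E₁ β' w'' L Br c := RouteSpec.mono spec subset_rfl hKD
      -- the exterior L-path from `(b, ya)` to `planar w'`, at height `h`
      obtain ⟨lp, hlp, hlpmem⟩ := exists_lpath_hv ((E.b, ya) : ℤ × ℤ) ew
      set X : List (slab 3 k) := liftH k h lp with hXdef
      have hXne : X ≠ [] := liftH_ne_nil hlp.ne_nil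
      have hXcol : ∀ x ∈ X, E.b ≤ (planar k x).1 ∧ ht x = h := by
        intro x hx
        rw [hXdef, mem_liftH_iff hhk] at hx
        refine ⟨?_, hx.2⟩
        rcases (hlpmem _).1 hx.1 with ⟨-, h2, -⟩ | ⟨h1, -, -⟩
        · simp only at h2; rw [min_eq_left hcase'] at h2; exact h2
        · rw [h1]; exact hcase'
      have hXK : ∀ x ∈ X, planar k x ∉ K := fun x hx => notK_b _ (hXcol x hx).1
      have hXD : ∀ x ∈ X, planar k x ∈ D := by
        intro x hx
        rw [hXdef, mem_liftH_iff hhk] at hx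
        rcases (hlpmem _).1 hx.1 with ⟨h1, h2, h3⟩ | ⟨h1, h2, h3⟩
        · simp only at h1 h2 h3
          refine memD' _ ?_ ?_ ?_ ?_ ?_ ?_ ?_ ?_ <;>
            · rw [min_def] at h2; rw [max_def] at h3; split_ifs at h2 h3 <;> omega
        · simp only at h1 h2 h3
          refine memD' _ ?_ ?_ ?_ ?_ ?_ ?_ ?_ ?_ <;>
            · rw [min_def] at h2; rw [max_def] at h3; split_ifs at h2 h3 <;> omega
      have hXhead : X.head? = some (vtx k (E.b, ya) h) := by
        rw [hXdef, head?_liftH, hlp.head]; rfl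
      have hXlast : X.getLast hXne = w' := by
        apply Option.some_injective
        rw [← List.getLast?_eq_some_getLast, hXdef, getLast?_liftH, hlp.last]
        simp [hewdef, hhdef, vtx_planar_ht]
      have hchX : (w'' :: X).IsChain (fun a b => (slabGraph 3 k).Adj a b) := by
        rw [List.isChain_cons]
        refine ⟨fun y hy => ?_, liftH_isChain h hlp.chain⟩
        rw [hXhead] at hy
        simp only [Option.mem_def, Option.some.injEq] at hy
        rw [← hy, hw''def]
        exact vtx_adj_vtx_planar (planarAdj_left (by simp) (by simp)) h
      have hXL : ∀ x ∈ X, x ∉ L := fun x hx hm => hXK x hx (spec.hL_sub x hm)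
      have hXBr : ∀ x ∈ X, x ∉ c :: Br := by
        intro x hx hm
        rcases List.mem_cons.1 hm with hm | hm
        · exact hXK x hx (hm ▸ spec.hL_sub c spec.hc)
        · exact hXK x hx (spec.hBr_sub x hm)
      have spec₂ := RouteSpec.append_branch X w'' Br hXne spec' hchX (liftH_nodup hlp.nodup) hXL hXBr hXD
      rw [hXlast] at spec₂
      refine ⟨L, Br ++ X, c, RouteSpec.mono spec₂ hKD subset_rfl, spec.hL_sub, fun hm => ?_⟩
      rcases List.mem_append.1 hm with hm | hm
      · exact notK_b _ (by rw [hβp]) (spec.hBr_sub β hm)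
      · exact hhβne (hβht ▸ (hXcol β hm).2)
  -- the trunk ends at `β`
  have spec₃ : RouteSpec k D D E₁ β w' (L ++ [β]) Br₁ c :=
    RouteSpec.concat_trunk spec₁ subset_rfl hadjβ (notK_L hLK) hβBr₁ hβD
  have hint : ∀ v ∈ L ++ [β], v ≠ E₁ → v ≠ β → planar k v ∈ E.Q.S ∧ planar k v ∉ E.Q.B := by
    intro v hv _ hvβ
    rcases List.mem_append.1 hv with hv | hv
    · exact ⟨ExtSetup.Kbox_subset_S _ _ (hLK v hv), ExtSetup.Kbox_disjoint_B (hLK v hv)⟩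
    · exact absurd (List.mem_singleton.1 hv) hvβ
  obtain ⟨sb, hsb⟩ := exists_surgeryB_of_decomp (Q := E.Q) (ExtSetup.Dbox_subset_R _ _) hDA hγeq hp₀
    hrest hp₀D hE₁D hE₁β hβD hβS hβB hadj hq₁D hc₀ hσ spec₃ hint
  exact ⟨sb, hsb ▸ hDz⟩

end Behind

/-! ## The trichotomy and the linear bound -/

section Gadget

variable {E : ExtSetup} {ω : BondConfig (slab 3 k)} {ρ : ℕ}

/-- **Every configuration of `𝒳` admits a local modification** (extended rectangle), with cleared
set inside a box of radius `3ρ + 3`: a direct gluing near `A` or near `C`, else a plain surgery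
(box left of `x = b`) or a surgery ending in `B̄` (box reaching `x = b`).
[cite: NewmanTassionWu2017, §3.2 (proof of Theorem 3.7, the map Φ : 𝒳 → 𝔓(𝒳′))] -/
theorem exists_gadget_ext (hk : 1 ≤ k) (hρ : 2 ≤ ρ)
    (hsep : ∀ a' ∈ E.A, ∀ c' ∈ E.C, c' ∉ sqBox a' (4 * ρ + 8))
    (hω : ω ⊆ (slabGraph 3 k).edgeSet) (hX : ω ∈ E.Q.evXn k ρ) :
    ∃ ω', GadgetSpec E.Q k (3 * ρ + 3) ω ω' := by
  obtain ⟨c₀, q, l, hc₀, hch, hnd, hsub, hhead, hnear, hfar⟩ := exists_contact hX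
  have hX' : ω ∈ E.Q.evX k := hX.1
  by_cases hA' : ∃ a' ∈ E.A, a' ∈ sqBox (planar k q) (ρ + 3)
  · obtain ⟨dg, hdg⟩ := exists_directGlue_A_ext hω hX' hsep hc₀ hch hnd hsub hhead hA'
    exact ⟨_, GadgetSpec.of_directGlue_A (Q := E.Q) hX' dg
      ⟨planar k q, hdg.trans (sqBox_mono _ (by omega))⟩⟩
  by_cases hC' : ∃ c' ∈ E.C, c' ∈ sqBox (planar k q) (ρ + 3)
  · obtain ⟨dg, hdg⟩ := exists_directGlue_C_ext hω hX' hsep hnear hC'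
    exact ⟨_, GadgetSpec.of_directGlue_C (Q := E.Q) hX' dg ⟨planar k q, hdg⟩⟩
  push Not at hA' hC'
  by_cases hcol : E.b ≤ (planar k q).1 + (ρ + 3)
  · obtain ⟨sb, hsb⟩ := exists_surgeryB_ext hk hρ hω hX' hc₀ hch hnd hsub hhead hnear hfar hA' hC' hcol
    exact ⟨_, GadgetSpec.of_surgeryB hX' sb ⟨planar k q, hsb.trans (sqBox_mono _ (by omega))⟩⟩
  · obtain ⟨sx, hsx⟩ := exists_surgery_ext hk hρ hω hX' hc₀ hch hnd hsub hhead hnear hfar hA' hC'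
      (by omega)
    exact ⟨_, GadgetSpec.of_surgery hX' sx ⟨planar k q, hsx.trans (sqBox_mono _ (by omega))⟩⟩

/-- **NTW 2017, Theorem 3.7 (GL), linear regime, extended rectangle**: for `S = [a,b]×[c,d] ⊆
R = [a,b']×[c,d']` in the slab `S_k` (`k ≥ 1`), `B = {b}×[c,d]`, `A ⊆ S` off the column `x = b`,
`C ⊆ R`, `dist*(A, C) > 4ρ + 8` (`ρ ≥ 2`), `0 < p < 1`:
`P_p[A ⟷^S B, C̄ ⟷^{R̄} 𝒩(Γ̄, ρ)] ≤ (1 + λ^s) · P_p[C ⟷^R A]` with `Γ = Γ_min^S(A, B)`,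
`λ = 2/min{p, 1-p}`, `s = 3(5k+4)(12ρ+13)²` — i.e. `P[C ⟷^R A] ≥ c₀ · P[A ⟷^S B, C ⟷^R 𝒩(Γ̄, ρ)]`,
the form `h₀(x) ≥ c₀ x` of Remark 3 after Theorem 3.7, which is what Case 2 of Theorem 3.14 uses.
[cite: NewmanTassionWu2017, Theorem 3.7 (with Remark 3, h₀(x) ≥ c₀ x)] -/
theorem real_evAB_inter_evNear_le_ext (E : ExtSetup) (hk : 1 ≤ k) {ρ : ℕ} (hρ : 2 ≤ ρ)
    (hsep : ∀ a' ∈ E.A, ∀ c' ∈ E.C, c' ∉ sqBox a' (4 * ρ + 8))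
    (p : unitInterval) (hp0 : 0 < (p : ℝ)) (hp1 : (p : ℝ) < 1) :
    (bondPercolation (slabGraph 3 k) p).real (E.Q.evAB k ∩ E.Q.evNear k ρ) ≤
      (1 + (2 / min (p : ℝ) (1 - p)) ^ (3 * ((5 * k + 4) * (2 * (2 * (3 * ρ + 3)) + 1) ^ 2))) *
        (bondPercolation (slabGraph 3 k) p).real (slabConn k E.R E.C E.A) :=
  real_evAB_inter_evNear_le_of_gadgets p hp0 hp1 (fun _ hω hX => exists_gadget_ext hk hρ hsep hω hX)

end Gadget

end NTW17

end Literature.Probability.Percolation
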